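import Summits.QuantumFields.BalabanUV.Beta.GAN24.FibreDetStrip
import Summits.QuantumFields.BalabanUV.Beta.GAN24.ArrowAnchorZero
import Summits.QuantumFields.BalabanUV.Beta.GAN24.ArrowInnerShift
import Summits.QuantumFields.BalabanUV.Beta.GAN24.ArrowAnchorReal
import Summits.QuantumFields.BalabanUV.Beta.GAN24.ArrowOuterShift

/-!
# `BalabanUV.Beta.GAN24.FibreDetStripHolds` — binder row G-an2-4 / (CONV-C), road P1-fibre, p1 row **P1-L10** `FibreStrip` ((I3′), the strip half of the K-slot),
# cut «(M4) scaled alias-space Neumann, two anchors» = SKELETON-P1 A5 v0.3 (`HOME/b2b-balaban-gan24-formalise-leaf-16/L10-CUT-M4.md`), row **F7** `FibreDetStrip`,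
# THE PLUG: (U1) on the whole strip, UNCONDITIONALLY, with ONE `κ₀ > 0` outside `∀ j`, from rows F3/F4/F5/F6 BY NAME

NOT IN PRINT; OUR PROOF ATTEMPT (of the road; THIS file is [folklore] bookkeeping: `GAN24/FibreDetStrip` (the rows as hypotheses) fed with the landed rows
F3 `ArrowAnchorZero.isUnit_innerArrow_zero` (aZ = 5/2), F4 `ArrowInnerShift.exists_cIn` (ρ₁ = 1/2), F5 `ArrowAnchorReal.exists_aR`, F6 `ArrowOuterShift.outerLipschitz`
(η₁ = 1, modulus `(1 + 1/|q|₂)³`), and part 1's `FibreDetStripOfAnchors.exists_radii`).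
HONEST FRAMING (cell contract, verbatim): «discharging `BetaPertH` makes Bałaban's UV stability UNCONDITIONAL — a real constructive-QFT result; it is NOT the continuum
limit and NOT the Clay problem.»  HONEST DEPENDENCY (verbatim): «continuum YM on T⁴ ⇐ BetaPertH ∧ nine spine estimates (0/9 proved); BetaPertH ⇐ (D1) ∧ (D4) ∧ CAP+tail;
G-an2-4 gates asym, D1 and NE2/3/4.»  No cited fact, no wall binder, no `def`, no `def … : Prop` hypothesis — every row enters BY NAME as a kernel-checked theorem.
WHAT THIS IS: (U1) of the L10 cut — the `hdet` hypothesis of `StripRegularPackaging.stripRegularK_of_det_bound` (the typer's `DetStrip d Lc κ₀`), now a THEOREM for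
SOME `κ₀ > 0` (existential, `κ₀ ≤ 1/4`), TOGETHER with the scaled a-priori bound row F8 consumes.  WHAT THIS IS NOT: not (U2), not (I3′) (F8/F9 outstanding), nothing
of the K-slot `GAN24.CombesThomas.ConvCK 3 Lc` of (CONV-C) is discharged by this file alone; 0 wall binders instantiated; NOT `BetaPertH`, NOT continuum, NOT Clay.
(Why a new module and not a v1.1 append of `FibreDetStrip.lean`: the gate's `dedup.landed` ∧ `theorems.append-only` lints deadlock on that file — journal NOTE
2026-08-20T01:21:59Z; `FibreDetStrip.lean` v1 is unchanged and correct.)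

## What is proved (generic `d`, `D = d+1`; `Lc ≥ 1`, `N = Lc^(j+1)`)
* §1 helpers: `strip_mono` (a smaller strip inherits any strip property), `abs_le_rad` (`|q μ| ≤ rad q = √(Σ q²)` — leaf-12's `ArrowAnchorRealCap.rad`),
  `omega_pow_le` (off the inner box, `(1 + 1/rad q)^k ≤ (1 + 2/ρ₀)^k`), `cOut_nonneg`-type positivity is inlined.
* §2 **`exists_strip`**: `∃ ρ₀ κ₀ A, 0 < ρ₀ ∧ 0 < κ₀ ∧ κ₀ ≤ ρ₀/2 ∧ κ₀ ≤ 1/4 ∧ 0 ≤ A ∧`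
  `(∀ j, ∀ p ∈ Strip (d+1) κ₀, det (trigPolySymbol (stencil (d+1)) (pieceMatrix (N := Lc^(j+1))) p) ≠ 0) ∧`   — (U1), `κ₀` OUTSIDE `∀ j` (ref2 r15 (b))
  `(∀ j, ∀ p ∈ Strip (d+1) κ₀, ((∀ μ, |Re p μ| < ρ₀/2) ∧ IsUnit (arrowMat (innerArrow (Lc^(j+1)) p)) ∧ ‖inverse‖ ≤ A) ∨`
  `   ((∃ μ, ρ₀/2 ≤ |Re p μ|) ∧ reVec p ∈ BZ (d+1) ∧ reVec p ≠ 0 ∧ IsUnit (arrowMat (outerArrow (Lc^(j+1)) (reVec p) p)) ∧ ‖inverse‖ ≤ A))`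
  — the input pair of row F8's `StripLegApriori.norm_kFibΔ_le_of_innerArrow/_of_outerArrow` with ONE constant `A = 2·max(5/2, aR)`; the region information gives
  row F9 the outer radius window (`|reVec p|₂ ≥ ρ₀/2`).
* §3 **`exists_detStrip`**: `∃ κ₀, 0 < κ₀ ∧ κ₀ ≤ 1/4 ∧ ∀ j, ∀ p ∈ Strip (d+1) κ₀, det … ≠ 0` — (U1) alone, and `detStrip_of_le` (any `0 < κ ≤ κ₀`).
Unit `b2b-balaban-gan24-formalise-leaf-09` (G-an2-4 formalisation swarm, leaf prover 09, gen 6; `CLAIM P1-L10-F7` journal 2026-08-20T00:52Z), 2026-08-20.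
-/

noncomputable section

open Matrix Complex
open scoped Matrix.Norms.L2Operator Real
open Literature.MathematicalPhysics.QuantumFieldTheory.Balaban1983to89
open Literature.MathematicalPhysics.QuantumFieldTheory.Balaban1983to89.Beta
open Literature.MathematicalPhysics.QuantumFieldTheory.King1986 (momSq)
open B4Strip (Strip reVec ofRealVec)
open B4ContourShift (BZ)
open BlochFibreMatrix (stencil pieceMatrix)
open FibreInverseDecay (trigPolySymbol reVec_mem_BZ)
open Summit.QuantumFields.BalabanUV.Beta.GAN24.ArrowOperator (arrowMat)
open Summit.QuantumFields.BalabanUV.Beta.GAN24.ArrowScaling (innerArrow outerArrow)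
open Summit.QuantumFields.BalabanUV.Beta.GAN24.ArrowAnchorRealCap (rad rad_nonneg)
open Summit.QuantumFields.BalabanUV.Beta.GAN24.FibreDetStripOfAnchors (one_add_inv_sqrt_le abs_le_sqrt_sum_sq exists_radii)
open Summit.QuantumFields.BalabanUV.Beta.GAN24.FibreDetStrip (detStrip_of_rows apriori_of_rows_step)
open Summit.QuantumFields.BalabanUV.Beta.GAN24.ArrowAnchorZero (isUnit_innerArrow_zero)
open Summit.QuantumFields.BalabanUV.Beta.GAN24.ArrowInnerShift (exists_cIn)
open Summit.QuantumFields.BalabanUV.Beta.GAN24.ArrowAnchorReal (exists_aR)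
open Summit.QuantumFields.BalabanUV.Beta.GAN24.ArrowOuterShift (outerLipschitz)

namespace Summit.QuantumFields.BalabanUV.Beta.GAN24.FibreDetStripHolds

/-! ## §1 Helpers -/

section Helpers

variable {D : ℕ}

/-- [folklore] A smaller strip inherits any strip property: `κ ≤ κ₀`, `P` on `Strip D κ₀` ⇒ `P` on `Strip D κ`. -/
theorem strip_mono {κ κ₀ : ℝ} (hκ : κ ≤ κ₀) {P : (Fin D → ℂ) → Prop} (h : ∀ p ∈ Strip D κ₀, P p) : ∀ p ∈ Strip D κ, P p :=
  fun p hp => h p fun μ => ⟨(hp μ).1, (hp μ).2.trans hκ⟩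

/-- [folklore] `rad q = √(Σ q²)` dominates every coordinate (`ArrowAnchorRealCap.rad` = `√momSq`). -/
theorem abs_le_rad (q : Fin D → ℝ) (μ : Fin D) : |q μ| ≤ rad q :=
  abs_le_sqrt_sum_sq q μ

/-- [folklore] The outer modulus at any power `k`: `(1 + 1/rad q)^k ≤ (1 + 2/ρ₀)^k` as soon as some `|q μ| ≥ ρ₀/2` (row F6 uses `k = 3`). -/
theorem omega_pow_le {ρ₀ : ℝ} (hρ₀ : 0 < ρ₀) (k : ℕ) {q : Fin D → ℝ} (hq : ∃ μ, ρ₀ / 2 ≤ |q μ|) :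
    (1 + 1 / rad q) ^ k ≤ (1 + 2 / ρ₀) ^ k := by
  obtain ⟨μ, hμ⟩ := hq
  have h : 1 + 1 / rad q ≤ 1 + 2 / ρ₀ := one_add_inv_sqrt_le hρ₀ hμ
  have h0 : 0 ≤ 1 + 1 / rad q := by have := rad_nonneg q; positivity
  exact pow_le_pow_left₀ h0 h k

/-- [folklore] The same written with `√(momSq q)` (the spelling of `ArrowOuterShift.outerLipschitz`). -/
theorem omega_cube_le {ρ₀ : ℝ} (hρ₀ : 0 < ρ₀) {q : Fin D → ℝ} (hq : ∃ μ, ρ₀ / 2 ≤ |q μ|) :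
    (1 + 1 / Real.sqrt (momSq q)) ^ 3 ≤ (1 + 2 / ρ₀) ^ 3 :=
  omega_pow_le hρ₀ 3 hq

/-- [folklore] Row F6's displayed constant is nonnegative. -/
theorem cOut_nonneg (D : ℕ) :
    0 ≤ (48 * (D : ℝ) ^ 2 + 4 * D) * (π / 2) * (1 + π / 2) ^ 2
        + 2 * Real.sqrt (49 * ((D : ℝ) + 1) ^ 3 * (1 + Real.sqrt D * π / 2) ^ 6 * (64 : ℝ) ^ (D + 1) * (5 : ℝ) ^ D) := by
  positivity

end Helpers

/-! ## §2 The plug: (U1) on the whole strip, one `κ₀`, together with the scaled a-priori bound for row F8 -/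

section Plug

variable {d Lc : ℕ} [NeZero Lc]

/-- [folklore] **ROW F7 — (U1) + THE SCALED A-PRIORI BOUND ON THE WHOLE STRIP, UNCONDITIONALLY.**  There are `0 < ρ₀`, `0 < κ₀ ≤ min(ρ₀/2, 1/4)` and `A ≥ 0`
(all depending on `d` only — NOT on `j`) such that for every step `j` (box side `N = Lc^(j+1)`) and every `p ∈ Strip (d+1) κ₀`:
(i) `det (trigPolySymbol (stencil (d+1)) pieceMatrix p) ≠ 0` — the `hdet` hypothesis of `StripRegularPackaging.stripRegularK_of_det_bound`; and
(ii) EITHER `|Re p|∞ < ρ₀/2` and the inner-scaled arrow matrix is invertible with `‖inverse‖ ≤ A`, OR some `|Re p μ| ≥ ρ₀/2`, `reVec p ∈ BZ ∖ {0}`, and the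
outer-scaled arrow matrix anchored at `reVec p` is invertible with `‖inverse‖ ≤ A` — the input of row F8's `StripLegApriori.norm_kFibΔ_le_of_innerArrow/_of_outerArrow`.
Rows BY NAME: F3 `isUnit_innerArrow_zero` (aZ = 5/2), F4 `exists_cIn` (ρ₁ = 1/2), F5 `exists_aR`, F6 `outerLipschitz` (η₁ = 1, used for η ≤ 1/4; modulus cubed,
`Ω = (1 + 2/ρ₀)³`); radii from part 1's `exists_radii`; composition = `FibreDetStrip.detStrip_of_rows` / `apriori_of_rows_step`. -/
theorem exists_strip :
    ∃ ρ₀ κ₀ A : ℝ, 0 < ρ₀ ∧ 0 < κ₀ ∧ κ₀ ≤ ρ₀ / 2 ∧ κ₀ ≤ 1 / 4 ∧ 0 ≤ A ∧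
      (∀ j : ℕ, ∀ p ∈ Strip (d + 1) κ₀, (trigPolySymbol (stencil (d + 1)) (pieceMatrix (N := Lc ^ (j + 1))) p).det ≠ 0) ∧
      (∀ j : ℕ, ∀ p ∈ Strip (d + 1) κ₀,
        ((∀ μ, |(p μ).re| < ρ₀ / 2) ∧ IsUnit (arrowMat (innerArrow (Lc ^ (j + 1)) p)) ∧
            ‖(arrowMat (innerArrow (Lc ^ (j + 1)) p))⁻¹‖ ≤ A) ∨
          ((∃ μ, ρ₀ / 2 ≤ |(p μ).re|) ∧ reVec p ∈ BZ (d + 1) ∧ reVec p ≠ 0 ∧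
            IsUnit (arrowMat (outerArrow (Lc ^ (j + 1)) (reVec p) p)) ∧ ‖(arrowMat (outerArrow (Lc ^ (j + 1)) (reVec p) p))⁻¹‖ ≤ A)) := by
  obtain ⟨cIn, hcIn, hF4⟩ := exists_cIn d
  obtain ⟨aR, haR, hF5⟩ := exists_aR (d + 1)
  -- F6's displayed constant
  set cOut : ℝ := (48 * ((d + 1 : ℕ) : ℝ) ^ 2 + 4 * ((d + 1 : ℕ) : ℝ)) * (π / 2) * (1 + π / 2) ^ 2
      + 2 * Real.sqrt (49 * (((d + 1 : ℕ) : ℝ) + 1) ^ 3 * (1 + Real.sqrt ((d + 1 : ℕ) : ℝ) * π / 2) ^ 6 * (64 : ℝ) ^ ((d + 1) + 1) * (5 : ℝ) ^ (d + 1))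
    with hcOut_def
  have hcOut : 0 ≤ cOut := cOut_nonneg (d + 1)
  -- radii: aZ = 5/2, ρ₁ = 1/2, η₁ = 1/4, Ω ρ = (1 + 2/ρ)^3
  obtain ⟨ρ₀, κ₀, hρ₀, hρ₁, hsmallIn, hκ₀, hκρ, hκη, hsmallOut⟩ :=
    exists_radii (aZ := 5 / 2) (aR := aR) (cIn := cIn) (cOut := cOut) (ρ₁ := 1 / 2) (η₁ := 1 / 4) (fun ρ => (1 + 2 / ρ) ^ 3)
      (by norm_num) haR hcIn hcOut (by norm_num) (by norm_num) (fun ρ hρ => by positivity)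
  have haZ : (0 : ℝ) ≤ 5 / 2 := by norm_num
  -- the four rows at N = Lc^(j+1), in the hypothesis shapes of `FibreDetStrip`
  have h3 : ∀ j : ℕ, IsUnit (arrowMat (innerArrow (Lc ^ (j + 1)) (0 : Fin (d + 1) → ℂ))) ∧
      ‖(arrowMat (innerArrow (Lc ^ (j + 1)) (0 : Fin (d + 1) → ℂ)))⁻¹‖ ≤ 5 / 2 := fun j => isUnit_innerArrow_zero
  have h4 : ∀ (j : ℕ) (p : Fin (d + 1) → ℂ) (r : ℝ), (∀ μ, ‖p μ‖ ≤ r) → r ≤ 1 / 2 →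
      ‖arrowMat (innerArrow (Lc ^ (j + 1)) p) - arrowMat (innerArrow (Lc ^ (j + 1)) 0)‖ ≤ cIn * r :=
    fun j p r hp hr => hF4 (Lc ^ (j + 1)) p r hp hr
  have h5 : ∀ (j : ℕ), ∀ q ∈ BZ (d + 1), q ≠ 0 → IsUnit (arrowMat (outerArrow (Lc ^ (j + 1)) q (ofRealVec q))) ∧
      ‖(arrowMat (outerArrow (Lc ^ (j + 1)) q (ofRealVec q)))⁻¹‖ ≤ aR :=
    fun j q hq hq0 => hF5 (Lc ^ (j + 1)) q (fun i => abs_le.mpr ⟨hq.1 i, hq.2 i⟩) hq0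
  have hN : ∀ j : ℕ, 1 ≤ Lc ^ (j + 1) := fun j => Nat.one_le_pow _ _ (Nat.pos_of_ne_zero (NeZero.ne Lc))
  have h6 : ∀ (j : ℕ), ∀ q ∈ BZ (d + 1), q ≠ 0 → ∀ p : Fin (d + 1) → ℂ, reVec p = q → ∀ η : ℝ, 0 ≤ η → η ≤ 1 / 4 →
      (∀ μ, |(p μ).im| ≤ η) →
      ‖arrowMat (outerArrow (Lc ^ (j + 1)) q p) - arrowMat (outerArrow (Lc ^ (j + 1)) q (ofRealVec q))‖
        ≤ cOut * η * (1 + 1 / Real.sqrt (momSq q)) ^ 3 :=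
    fun j q hq hq0 p hpq η hη0 hη1 him => by
      have h := outerLipschitz (D := d + 1) (N := Lc ^ (j + 1)) (hN j) q hq hq0 p hpq η hη0 (hη1.trans (by norm_num)) him
      rw [hcOut_def]
      exact h
  have hω : ∀ q ∈ BZ (d + 1), (∃ μ, ρ₀ / 2 ≤ |q μ|) → (1 + 1 / Real.sqrt (momSq q)) ^ 3 ≤ (1 + 2 / ρ₀) ^ 3 :=
    fun q _ hq => omega_cube_le hρ₀ hq
  refine ⟨ρ₀, κ₀, 2 * max (5 / 2) aR, hρ₀, hκ₀, hκρ, hκη, by positivity, ?_, ?_⟩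
  · exact detStrip_of_rows (fun q => (1 + 1 / Real.sqrt (momSq q)) ^ 3) h3 h4 h5 h6 hω haZ haR hcOut hρ₀ hρ₁ hsmallIn hκ₀.le hκρ hκη
      hsmallOut
  · intro j p hp
    rcases apriori_of_rows_step (fun q => (1 + 1 / Real.sqrt (momSq q)) ^ 3) h3 h4 h5 h6 hω haZ haR hcOut hρ₀ hρ₁ hsmallIn hκ₀.le hκρ
        hκη hsmallOut j hp with ⟨hin, hU, hb⟩ | ⟨hout, hq0, hU, hb⟩
    · exact Or.inl ⟨hin, hU, hb.trans (by linarith [le_max_left (5 / 2 : ℝ) aR])⟩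
    · exact Or.inr ⟨hout, reVec_mem_BZ hp, hq0, hU, hb.trans (by linarith [le_max_right (5 / 2 : ℝ) aR])⟩

/-! ## §3 (U1) alone -/

/-- [folklore] **(U1) — `DetStrip d Lc κ₀` FOR SOME `0 < κ₀ ≤ 1/4`, UNCONDITIONALLY**: for every step `j` the Bloch-fibre determinant of the U = 1 KKT stencil at
`N = Lc^(j+1)` has no zero on the closed strip `Strip (d+1) κ₀` — literally the hypothesis `hdet` of `StripRegularPackaging.stripRegularK_of_det_bound`, with
ONE `κ₀` outside `∀ j`. -/
theorem exists_detStrip :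
    ∃ κ₀ : ℝ, 0 < κ₀ ∧ κ₀ ≤ 1 / 4 ∧
      ∀ j : ℕ, ∀ p ∈ Strip (d + 1) κ₀, (trigPolySymbol (stencil (d + 1)) (pieceMatrix (N := Lc ^ (j + 1))) p).det ≠ 0 := by
  obtain ⟨ρ₀, κ₀, A, -, hκ₀, -, hκ4, -, hdet, -⟩ := exists_strip (d := d) (Lc := Lc)
  exact ⟨κ₀, hκ₀, hκ4, hdet⟩

/-- [folklore] (U1) on any smaller strip: if `det ≠ 0` on `Strip (d+1) κ₀` for all `j` and `κ ≤ κ₀`, then the same on `Strip (d+1) κ` (F9 may shrink `κ₀` to any `min`). -/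
theorem detStrip_of_le {κ κ₀ : ℝ} (hκ : κ ≤ κ₀)
    (h : ∀ j : ℕ, ∀ p ∈ Strip (d + 1) κ₀, (trigPolySymbol (stencil (d + 1)) (pieceMatrix (N := Lc ^ (j + 1))) p).det ≠ 0) :
    ∀ j : ℕ, ∀ p ∈ Strip (d + 1) κ, (trigPolySymbol (stencil (d + 1)) (pieceMatrix (N := Lc ^ (j + 1))) p).det ≠ 0 :=
  fun j => strip_mono hκ (h j)

end Plug

end Summit.QuantumFields.BalabanUV.Beta.GAN24.FibreDetStripHolds

end
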